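import Summits.ABC.IUTFork.Thm311RealInd1StripPacketDualBoxSharpIffUnion
import Summits.ABC.IUTFork.Thm311RealInd1StripPacketMonomialFloorPorts
import HarnessLib

/-!
# [IUTchIII] Thm 3.11 (i) (Ind1)+(Ind2) ⟶ Cor 3.12 at ONE PRIME, both readings: the tame dichotomy at the `ln ν̄_{𝕃_p}` level as ONE displayed equivalence —
# `ln ν̄_{𝕃_p}` of reading (P) (resp. (U)) over a factorwise-strip `H ≤ indTwo` containing the single-factor strip moves EQUALS the Dupuy–Hilado container's
# `−|log(Θ)|^{(P)}_p` (resp. `−|log(Θ)|_p`) IF AND ONLY IF EVERY collection of the section over `p` has room at its twisted slot (resp. at some content-minimising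
# slot); otherwise it is STRICTLY smaller (⟸ mod `JannsenWingbergMappingClass`, ⟹ unconditional)

PROOF-ONLY file (abc-iut cell, Cor. 3.12 sub-crew, seat abc-iut-c312-1 = holder of record of the typed [IUTchIII] Thm. 3.11, gen 22; offer (ρ) «C:DICHOTOMY-IFF»,
file 2 — assembles R28 (λ3) `Thm311RealInd1StripPacketDualBoxSharpIff` / file 1 `…DualBoxSharpIffUnion` (identity sides, per collection) with gen 21's (π′3)/(π′4)
`Thm311RealInd1StripPacketDualBoxVolume{PerImage,Union}` (strict drops) over abc-iut-c312-d1's `ln ν̄_{𝕃_p}` bookkeeping).  TAKES NO SIDE on [IUTchIII] Cor. 3.12.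
No definition, no `Prop` fact.  CONDITIONAL on `JannsenWingbergMappingClass` (binder `hMC`) ONLY in the directions room ⟹ identity; identity ⟹ room UNCONDITIONAL.

SETTING.  The real prime packet `Q = realPrimePacketWith p (σ.localFields p) c` over the GENUINE completions `K_{v̲}` of a place section `σ : V(F₀) → V(K)` (any
shell normalisation `c`), a `p`-local Θ-idele `t = (t_{i,v})`, every place `v̲ ∣ p` of the section TAME (`p > 2`, `e ≤ p − 2`) of ODD local degree `≥ 3` and ANY
residue degree; a bit ORACLE `bit : V(F₀)_p → Prop` correct at the residue-degree-one places (`hbit`: where it says yes some realised strip automorphism of `K_{v̲}`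
moves `ℤ_p·p` modulo `p·log_p(𝒪^×)`; `hfix`: where it says no, none does; NOT READ where `f > 1`); at a collection `v⃗ = e` the bit set is
`S(v⃗) = {b : f(v̲_b|p) ≠ 1 ∨ bit(v_b)}`; a family `H = (H_{j,v⃗})` of subgroups of the packet automorphisms with `H_{j,v⃗} ≤ indTwo` (the Dupuy–Hilado container)
containing the single-factor (Ind1) strip moves and acting factorwise through the realised strip groups (degrees `j = i+1 ≤ ℓ⋆`).
* §1 **`localFields_packetHull_orbitH_pilotRegion_eq_slotImagesHull_iff_room_of_jannsenWingbergMappingClass`** — the place-section port of R28 (λ3) at ONE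
  collection (reading (P)): `hull(H-orbit of O_𝕃(−P_Θ)_{v⃗}) = slotImagesHull ⟺ ((v−1) % e(v̲_j|p) + 1)/e(v̲_j|p) + Σ_{b∉S(v⃗)} 1/e(v̲_b|p) ≤ 1`, `‖t_{i,v_j}‖ = p^{−v/e(v̲_j|p)}`.
* §2 **`localFields_lnνLp_hull_orbitH_eq_negLogThetaPerImageAt_iff_forall_room_of_jannsenWingbergMappingClass`** — READING (P), valuation family `v(i,v⃗)` of `t`
  at the twisted (last) slots: **`ln ν̄_{𝕃_p}(v⃗ ↦ hull(⋃_{g∈H_{v⃗}} g(O_𝕃(−P_Θ)_{v⃗}))) = −|log(Θ)|^{(P)}_p ⟺ ∀ (i, v⃗), room(i, v⃗)`** (⟸: §1 at every collection,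
  assembled by R17b `realPrimePacketWith_lnνLp_hull_orbitH_eq_negLogThetaPerImageAt_of_forall_eq`; ⟹: ONE collection without room makes the left side `<` the
  right, gen 21's (π′3) `localFields_lnνLp_hull_orbitH_lt_negLogThetaPerImageAt_of_not_room_mixed`, unconditional).
* §3 **`localFields_lnνLp_hull_orbitH_indOneUnion_eq_negLogThetaAt_iff_forall_exists_room_at_min_of_jannsenWingbergMappingClass`** — READING (U) (the cell's
  reading of record), valuation family `v(i,v⃗,a)` at every slot: **`ln ν̄_{𝕃_p}(v⃗ ↦ hull(⋃_{g∈H_{v⃗}} g(⋃_σ σ·O_𝕃(−P_Θ)_{v⃗∘σ}))) = −|log(Θ)|_p ⟺ ∀ (i, v⃗) ∃ a`**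
  content-minimising with `((v(i,v⃗,a)−1) % e(v̲_a|p) + 1)/e(v̲_a|p) + Σ_{b∉S(v⃗)} 1/e(v̲_b|p) ≤ 1` (⟸: file 1 §3 at every collection + abc-iut-c312-d1's
  `lnνLp_congr_of_succ`; ⟹: (π′4) `localFields_lnνLp_hull_orbitH_indOneUnion_lt_negLogThetaAt_of_not_room_at_min`, unconditional).
* §4 NON-VACUITY **`exists_subgroupFamily_le_indTwo_stripMoves_factorwise`** — the three hypotheses on the FAMILY `H` are jointly inhabited (R28 (λ3)
  `exists_subgroup_le_indTwo_stripMoves_factorwise` at every collection; unconditional).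
READING (numbers about OUR typed objects; neutral): at a prime `p > 2` over which every place of the section is tame of odd local degree `≥ 3`, the Θ-side of
[IUTchIII] Cor. 3.12 computed over print's (Ind1)⊔(Ind2) AS TYPED (any such `H`) is EITHER the Dupuy–Hilado number (`−|log(Θ)|^{(P)}_p`, resp. `−|log(Θ)|_p`) —
exactly when every collection passes its room test — OR strictly below it by at least R29's margin `Pr(v⃗)·(Σ_j f(L_j)/D)·(log p)/ℓ⋆`; the test reads only
`(ord t_{i,v}, e(v̲|p), f(v̲|p), bit(v))`.  With abc-iut-c312-d1's monotonicity (always `≤`) the second branch makes Cor. 3.12 over such an `H` STRICTLY HARDER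
than over the container at `p`.  Which value a bit takes, and which branch a given Θ-datum is in, is NOT claimed.  HONEST SCOPE: ⟸ mod
`JannsenWingbergMappingClass`, ⟹ unconditional; OUR typings (THE equivariant lift, THE logarithm, factorwise action; F-B28-1 untouched); EVEN degree, WILD,
`p = 2` outside; equal-AS-TYPED ≠ equal in print; nothing here asserts that abc is proved or refuted; no side taken on [IUTchIII] Cor. 3.12 / [IUTchIV]
Thm. 1.10, on (U) vs (P), or on any author. [claim: Mochizuki2012, status: disputed]; [cite: Mochizuki2012, IUTchIII Thm. 3.11 (i) p. 154; Rmk. 3.9.5 (i)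
p. 127; Cor. 3.12 p. 174, Steps (x)/(xi) pp. 181–183; IUTchIV Prop. 1.1 p. 9, Prop. 1.2 (ii) pp. 10–11, Prop. 1.4 (iii) p. 13]; [cite: Kondo2025OuterAutMLF,
§3 Thm 3.17, Rem 3.18]; [cite: DupuyHilado2025, §3.6, Def. 3.6.3, §4.7, §4.9, §4.11, §4.12]. typed ≠ proved; a conditional theorem discharges nothing it binds.
-/

set_option autoImplicit false

noncomputable section

open Metric Set Function Module
open scoped Pointwise TensorProduct

namespace Summit.ABC.IUTFork.Thm311.Real

open NumberField IsDedekindDomain Literature.NumberTheory.NumberFields Literature.IUT.LogVolume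
open Literature.NumberTheory.GaloisRepresentations Literature.NumberTheory.GaloisRepresentations.Ultrametric
open Literature.AnabelianGeometry.AbsoluteAnabelian Literature.IUT.HodgeArakelov
open Literature.IUT.HodgeArakelov.AbsTopMonoids

section PlaceSection

variable {F₀ : Type} [Field F₀] [NumberField F₀] {K : Type} [Field K] [NumberField K] [Algebra F₀ K]
variable (σ : PlaceSection F₀ K) (p : ℕ) [hp : Fact p.Prime]
variable (c : (j : ℕ) → (Fin (j + 1) → placesOver F₀ p) → ℚ_[p]) (hc0 : ∀ j e, c j e ≠ 0)
  (hcσ : ∀ (j : ℕ) (τ : Equiv.Perm (Fin (j + 1))) (e : Fin (j + 1) → placesOver F₀ p), c j (e ∘ τ) = c j e)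

/-! ## §1 Reading (P) at ONE collection: the place-section port of R28 (λ3) -/

/-- **READING (P) AT A GENUINE COLLECTION: hull of the `H`-orbit of `O_𝕃(−P_Θ)_{v⃗}` = slotImagesHull ⟺ ROOM AT THE TWISTED SLOT (⟸ mod
`JannsenWingbergMappingClass`, ⟹ unconditional).**  The place-section port of R28 (λ3) `packetHull_orbit_eq_container_iff_room_of_jannsenWingbergMappingClass`:
collection `v⃗ = e`, every factor TAME of ODD local degree `≥ 3`, ANY residue degrees, `‖t_{i,v_j}‖ = p^{−v/e(v̲_j|p)}` at the twisted (last) slot; bit oracle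
`bit` correct at the residue-degree-one factors, `S = {b : f(v̲_b|p) ≠ 1 ∨ bit_b}`; `H ≤ indTwo` containing the single-factor strip moves and acting factorwise.
Then `hull(H-orbit of O_𝕃(−P_Θ)_{v⃗}) = slotImagesHull ⟺ ((v−1) % e(v̲_j|p) + 1)/e(v̲_j|p) + Σ_{b∉S} 1/e(v̲_b|p) ≤ 1` (R22's unconditional tame content
identity `slotImagesHull = packetHull(p^{A}·log_p(R_I^×))` + abc-iut-c312-3's `realPrimePacketWith_pilotRegion_succ_eq`).
[claim: Mochizuki2012, status: disputed] [cite: Mochizuki2012, IUTchIII Thm. 3.11 (i) p. 154; Rmk. 3.9.5 (i) p. 127; Cor. 3.12 Steps (x)/(xi) pp. 181–183;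
IUTchIV Prop. 1.1 p. 9, Prop. 1.2 (ii) pp. 10–11] [cite: Kondo2025OuterAutMLF, §3 Thm 3.17, Rem 3.18] [cite: DupuyHilado2025, §4.9, §4.12] -/
theorem localFields_packetHull_orbitH_pilotRegion_eq_slotImagesHull_iff_room_of_jannsenWingbergMappingClass
    (hMC : JannsenWingbergMappingClass) (hp2 : 2 < p) {lstar : ℕ}
    (t : Fin lstar → (v : placesOver F₀ p) → ((σ.localFields p).k v)ˣ) (i : Fin lstar)
    (e : Fin ((i : ℕ) + 1 + 1) → placesOver F₀ p)
    (he : ∀ b, absRamificationIdx p ((σ.localFields p).k (e b)) ≤ p - 2)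
    (h3 : ∀ b, 3 ≤ localDeg K (σ.lift (e b).1)) (hodd : ∀ b, Odd (localDeg K (σ.lift (e b).1)))
    {v : ℤ} (hv : ‖(t i (e (Fin.last _)) : (σ.localFields p).k (e (Fin.last _)))‖ =
      (p : ℝ) ^ (-(v / (absRamificationIdx p ((σ.localFields p).k (e (Fin.last _))) : ℝ))))
    (bit : Fin ((i : ℕ) + 1 + 1) → Prop) [DecidablePred bit]
    (hbit : ∀ b, (σ.lift (e b).1).asIdeal.inertiaDeg ℤ = 1 → bit b →
      ∃ ψ ∈ ind1StripOf (σ.lift (e b).1) (galoisLog (σ.lift (e b).1)),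
        RescaledCompletion.of K p (σ.lift (e b).1) (σ.natCast_mem_lift (e b)) (ψ (p : (σ.lift (e b).1).adicCompletion K)) -
            (p : RescaledCompletion K p (σ.lift (e b).1) (σ.natCast_mem_lift (e b))) ∉
          (p : ℚ_[p]) • logUnits (RescaledCompletion K p (σ.lift (e b).1) (σ.natCast_mem_lift (e b))))
    (hfix : ∀ b, (σ.lift (e b).1).asIdeal.inertiaDeg ℤ = 1 → ¬ bit b →
      ∀ ψ ∈ ind1StripOf (σ.lift (e b).1) (galoisLog (σ.lift (e b).1)),
        RescaledCompletion.of K p (σ.lift (e b).1) (σ.natCast_mem_lift (e b)) (ψ (p : (σ.lift (e b).1).adicCompletion K)) -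
            (p : RescaledCompletion K p (σ.lift (e b).1) (σ.natCast_mem_lift (e b))) ∈
          (p : ℚ_[p]) • logUnits (RescaledCompletion K p (σ.lift (e b).1) (σ.natCast_mem_lift (e b))))
    (H : Subgroup (PacketAlgebra p (fun b => (σ.localFields p).k (e b)) ≃ₗ[ℚ_[p]]
      PacketAlgebra p (fun b => (σ.localFields p).k (e b))))
    (hH : H ≤ indTwo p (fun b => (σ.localFields p).k (e b)))
    (hstrip : ∀ (b₀ : Fin ((i : ℕ) + 1 + 1)),
      ∀ ψ ∈ ind1StripOf (σ.lift (e b₀).1) (galoisLog (σ.lift (e b₀).1)), ∃ γ ∈ H,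
        ∀ z : ∀ b, (σ.localFields p).k (e b),
          (γ : PacketAlgebra p (fun b => (σ.localFields p).k (e b)) ≃ₗ[ℚ_[p]]
              PacketAlgebra p (fun b => (σ.localFields p).k (e b))) (PiTensorProduct.tprod ℚ_[p] z) =
            PiTensorProduct.tprod ℚ_[p] (update z b₀
              (RescaledCompletion.of K p (σ.lift (e b₀).1) (σ.natCast_mem_lift (e b₀))
                (ψ ((RescaledCompletion.of K p (σ.lift (e b₀).1) (σ.natCast_mem_lift (e b₀))).symm (z b₀))))))
    (hHfac : ∀ γ ∈ H, ∃ δ : Π b, AddAut ((σ.lift (e b).1).adicCompletion K),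
      (∀ b, δ b ∈ AddSubgroup.closure (G := AddAut ((σ.lift (e b).1).adicCompletion K))
        (ind1StripOf (σ.lift (e b).1) (galoisLog (σ.lift (e b).1)))) ∧
      ∀ z : Π b, (σ.localFields p).k (e b),
        (γ : PacketAlgebra p (fun b => (σ.localFields p).k (e b)) ≃ₗ[ℚ_[p]]
            PacketAlgebra p (fun b => (σ.localFields p).k (e b))) (PiTensorProduct.tprod ℚ_[p] z) =
          PiTensorProduct.tprod ℚ_[p] (fun b => RescaledCompletion.of K p (σ.lift (e b).1) (σ.natCast_mem_lift (e b))
            (δ b ((RescaledCompletion.of K p (σ.lift (e b).1) (σ.natCast_mem_lift (e b))).symm (z b))))) :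
    packetHull p (fun b => (σ.localFields p).k (e b))
        (⋃ γ : H, (γ : PacketAlgebra p (fun b => (σ.localFields p).k (e b)) ≃ₗ[ℚ_[p]]
            PacketAlgebra p (fun b => (σ.localFields p).k (e b))) ''
          (realPrimePacketWith p (σ.localFields p) c hc0 hcσ).pilotRegion t ((i : ℕ) + 1) e) =
      (realPrimePacketWith p (σ.localFields p) c hc0 hcσ).slotImagesHull
        ((realPrimePacketWith p (σ.localFields p) c hc0 hcσ).pilotRegion t) ((i : ℕ) + 1) e ↔
    (((v - 1) % (absRamificationIdx p ((σ.localFields p).k (e (Fin.last _))) : ℤ) + 1 : ℤ) : ℝ) /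
        (absRamificationIdx p ((σ.localFields p).k (e (Fin.last _))) : ℝ) +
      ∑ b ∈ Finset.univ \ Finset.univ.filter (fun b => (σ.lift (e b).1).asIdeal.inertiaDeg ℤ ≠ 1 ∨ bit b),
        (1 : ℝ) / (absRamificationIdx p ((σ.localFields p).k (e b)) : ℝ) ≤ 1 := by
  rw [realPrimePacketWith_slotImagesHull_pilotRegion_eq_of_tame p (σ.localFields p) c hc0 hcσ hp2 t i e he hv,
    realPrimePacketWith_pilotRegion_succ_eq]
  exact packetHull_orbit_eq_container_iff_room_of_jannsenWingbergMappingClass p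
    (fun b => σ.lift (e b).1) (fun b => σ.natCast_mem_lift (e b)) hMC hp2 he h3 hodd (Fin.last _) hv bit hbit hfix H hH hstrip hHfac


/-! ## §2 Reading (P) at the prime: `ln ν̄_{𝕃_p}` EQUALS `−|log(Θ)|^{(P)}_p` ⟺ every collection has room at its twisted slot -/

/-- **READING (P) AT THE PRIME: `ln ν̄_{𝕃_p}(reading (P) over H) = −|log(Θ)|^{(P)}_p ⟺ EVERY COLLECTION HAS ROOM AT ITS TWISTED SLOT (⟸ mod
`JannsenWingbergMappingClass`, ⟹ unconditional).**  Every place of the section over `p` tame of odd local degree `≥ 3` (any residue degree); valuation family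
`‖t_{i,v_j}‖ = p^{−v(i,v⃗)/e(v̲_j|p)}` at the twisted (last) slot of every collection; bit oracle `bit` per place, correct at the residue-degree-one places;
`H_{j,v⃗} ≤ indTwo` containing the single-factor strip moves and acting factorwise.  Then
`ln ν̄_{𝕃_p}(v⃗ ↦ hull(⋃_{g∈H_{v⃗}} g(O_𝕃(−P_Θ)_{v⃗}))) = −|log(Θ)|^{(P)}_p ⟺ ∀ (i,v⃗), ((v(i,v⃗)−1) % e(v̲_j|p) + 1)/e(v̲_j|p) + Σ_{b : f(v̲_b|p) = 1 ∧ ¬bit(v_b)} 1/e(v̲_b|p) ≤ 1`;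
when the right side fails the left side is `<` (gen 21's (π′3)). [claim: Mochizuki2012, status: disputed]
[cite: Mochizuki2012, IUTchIII Thm. 3.11 (i) p. 154; Cor. 3.12 proof Step (x) p. 181, Step (xi) p. 183; IUTchIV Prop. 1.1 p. 9, Prop. 1.2 (ii) pp. 10–11]
[cite: Kondo2025OuterAutMLF, §3 Thm 3.17, Rem 3.18] [cite: DupuyHilado2025, Def. 3.6.3, §4.9, §4.12] -/
theorem localFields_lnνLp_hull_orbitH_eq_negLogThetaPerImageAt_iff_forall_room_of_jannsenWingbergMappingClass
    (hMC : JannsenWingbergMappingClass) (hp2 : 2 < p) {lstar : ℕ}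
    (t : Fin lstar → (v : placesOver F₀ p) → ((σ.localFields p).k v)ˣ)
    (he : ∀ v : placesOver F₀ p, absRamificationIdx p ((σ.localFields p).k v) ≤ p - 2)
    (h3 : ∀ v : placesOver F₀ p, 3 ≤ localDeg K (σ.lift v.1)) (hodd : ∀ v : placesOver F₀ p, Odd (localDeg K (σ.lift v.1)))
    (v : (i : Fin lstar) → (Fin ((i : ℕ) + 1 + 1) → placesOver F₀ p) → ℤ)
    (hv : ∀ (i : Fin lstar) (e : Fin ((i : ℕ) + 1 + 1) → placesOver F₀ p),
      ‖(t i (e (Fin.last _)) : (σ.localFields p).k (e (Fin.last _)))‖ =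
        (p : ℝ) ^ (-(v i e / (absRamificationIdx p ((σ.localFields p).k (e (Fin.last _))) : ℝ))))
    (bit : placesOver F₀ p → Prop) [DecidablePred bit]
    (hbit : ∀ w : placesOver F₀ p, (σ.lift w.1).asIdeal.inertiaDeg ℤ = 1 → bit w →
      ∃ ψ ∈ ind1StripOf (σ.lift w.1) (galoisLog (σ.lift w.1)),
        RescaledCompletion.of K p (σ.lift w.1) (σ.natCast_mem_lift w) (ψ (p : (σ.lift w.1).adicCompletion K)) -
            (p : RescaledCompletion K p (σ.lift w.1) (σ.natCast_mem_lift w)) ∉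
          (p : ℚ_[p]) • logUnits (RescaledCompletion K p (σ.lift w.1) (σ.natCast_mem_lift w)))
    (hfix : ∀ w : placesOver F₀ p, (σ.lift w.1).asIdeal.inertiaDeg ℤ = 1 → ¬ bit w →
      ∀ ψ ∈ ind1StripOf (σ.lift w.1) (galoisLog (σ.lift w.1)),
        RescaledCompletion.of K p (σ.lift w.1) (σ.natCast_mem_lift w) (ψ (p : (σ.lift w.1).adicCompletion K)) -
            (p : RescaledCompletion K p (σ.lift w.1) (σ.natCast_mem_lift w)) ∈
          (p : ℚ_[p]) • logUnits (RescaledCompletion K p (σ.lift w.1) (σ.natCast_mem_lift w)))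
    (H : (j : ℕ) → (e : Fin (j + 1) → placesOver F₀ p) →
      Subgroup (PacketAlgebra p (fun b => (σ.localFields p).k (e b)) ≃ₗ[ℚ_[p]]
        PacketAlgebra p (fun b => (σ.localFields p).k (e b))))
    (hH : ∀ j e, H j e ≤ indTwo p (fun b => (σ.localFields p).k (e b)))
    (hstrip : ∀ (i : Fin lstar) (e : Fin ((i : ℕ) + 1 + 1) → placesOver F₀ p) (b₀ : Fin ((i : ℕ) + 1 + 1)),
      ∀ ψ ∈ ind1StripOf (σ.lift (e b₀).1) (galoisLog (σ.lift (e b₀).1)), ∃ γ ∈ H ((i : ℕ) + 1) e,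
        ∀ z : ∀ b, (σ.localFields p).k (e b),
          (γ : PacketAlgebra p (fun b => (σ.localFields p).k (e b)) ≃ₗ[ℚ_[p]]
              PacketAlgebra p (fun b => (σ.localFields p).k (e b))) (PiTensorProduct.tprod ℚ_[p] z) =
            PiTensorProduct.tprod ℚ_[p] (update z b₀
              (RescaledCompletion.of K p (σ.lift (e b₀).1) (σ.natCast_mem_lift (e b₀))
                (ψ ((RescaledCompletion.of K p (σ.lift (e b₀).1) (σ.natCast_mem_lift (e b₀))).symm (z b₀))))))
    (hHfac : ∀ (i : Fin lstar) (e : Fin ((i : ℕ) + 1 + 1) → placesOver F₀ p), ∀ γ ∈ H ((i : ℕ) + 1) e,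
      ∃ δ : Π b, AddAut ((σ.lift (e b).1).adicCompletion K),
        (∀ b, δ b ∈ AddSubgroup.closure (G := AddAut ((σ.lift (e b).1).adicCompletion K))
          (ind1StripOf (σ.lift (e b).1) (galoisLog (σ.lift (e b).1)))) ∧
        ∀ z : Π b, (σ.localFields p).k (e b),
          (γ : PacketAlgebra p (fun b => (σ.localFields p).k (e b)) ≃ₗ[ℚ_[p]]
              PacketAlgebra p (fun b => (σ.localFields p).k (e b))) (PiTensorProduct.tprod ℚ_[p] z) =
            PiTensorProduct.tprod ℚ_[p] (fun b => RescaledCompletion.of K p (σ.lift (e b).1) (σ.natCast_mem_lift (e b))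
              (δ b ((RescaledCompletion.of K p (σ.lift (e b).1) (σ.natCast_mem_lift (e b))).symm (z b))))) :
    (realPrimePacketWith p (σ.localFields p) c hc0 hcσ).lnνLp lstar (fun j e =>
        packetHull p (fun b => (σ.localFields p).k (e b))
          (⋃ g : H j e, (g : PacketAlgebra p (fun b => (σ.localFields p).k (e b)) ≃ₗ[ℚ_[p]]
              PacketAlgebra p (fun b => (σ.localFields p).k (e b))) ''
            (realPrimePacketWith p (σ.localFields p) c hc0 hcσ).pilotRegion t j e)) =
      (realPrimePacketWith p (σ.localFields p) c hc0 hcσ).negLogThetaPerImageAt lstar t ↔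
    ∀ (i : Fin lstar) (e : Fin ((i : ℕ) + 1 + 1) → placesOver F₀ p),
      (((v i e - 1) % (absRamificationIdx p ((σ.localFields p).k (e (Fin.last _))) : ℤ) + 1 : ℤ) : ℝ) /
          (absRamificationIdx p ((σ.localFields p).k (e (Fin.last _))) : ℝ) +
        ∑ b ∈ Finset.univ \ Finset.univ.filter (fun b => (σ.lift (e b).1).asIdeal.inertiaDeg ℤ ≠ 1 ∨ bit (e b)),
          (1 : ℝ) / (absRamificationIdx p ((σ.localFields p).k (e b)) : ℝ) ≤ 1 := by
  classical
  constructor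
  · intro hEq i₁ e₁
    by_contra hnot
    -- the bit set of the collection `e₁` and what holds off it
    set S : Finset (Fin ((i₁ : ℕ) + 1 + 1)) :=
      Finset.univ.filter (fun b => (σ.lift (e₁ b).1).asIdeal.inertiaDeg ℤ ≠ 1 ∨ bit (e₁ b)) with hS
    have hmemS : ∀ b, b ∈ S ↔ (σ.lift (e₁ b).1).asIdeal.inertiaDeg ℤ ≠ 1 ∨ bit (e₁ b) := fun b => by simp [hS]
    have hfS : ∀ b, b ∉ S → (σ.lift (e₁ b).1).asIdeal.inertiaDeg ℤ = 1 := fun b hb => by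
      by_contra h; exact hb ((hmemS b).mpr (Or.inl h))
    have hbS : ∀ b, b ∉ S → ¬ bit (e₁ b) := fun b hb hbit' => hb ((hmemS b).mpr (Or.inr hbit'))
    have he2 : ∀ b, b ∉ S → 2 ≤ absRamificationIdx p (RescaledCompletion K p (σ.lift (e₁ b).1) (σ.natCast_mem_lift (e₁ b))) :=
      fun b hb => by
        have h := h3 (e₁ b)
        rw [localDeg, hfS b hb, mul_one, ← absRamificationIdx_rescaledCompletion K p (σ.lift (e₁ b).1) (σ.natCast_mem_lift (e₁ b))] at h
        omega
    have hlt := localFields_lnνLp_hull_orbitH_lt_negLogThetaPerImageAt_of_not_room_mixed σ p c hc0 hcσ hp2 t H hH i₁ e₁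
      (fun b => he (e₁ b)) (hv i₁ e₁) S he2 hfS (fun b hb => hfix (e₁ b) (hfS b hb) (hbS b hb)) hnot (hHfac i₁ e₁)
    rw [hEq] at hlt
    exact lt_irrefl _ hlt
  · intro hroom
    refine realPrimePacketWith_lnνLp_hull_orbitH_eq_negLogThetaPerImageAt_of_forall_eq p (σ.localFields p) c hc0 hcσ t H fun i e => ?_
    exact (localFields_packetHull_orbitH_pilotRegion_eq_slotImagesHull_iff_room_of_jannsenWingbergMappingClass σ p c hc0 hcσ hMC hp2 t i e
      (fun b => he (e b)) (fun b => h3 (e b)) (fun b => hodd (e b)) (hv i e) (fun b => bit (e b))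
      (fun b hf1 hb => hbit (e b) hf1 hb) (fun b hf1 hb => hfix (e b) hf1 hb) (H _ e) (hH _ e) (hstrip i e) (hHfac i e)).mpr
      (hroom i e)

/-! ## §3 Reading (U) at the prime: `ln ν̄_{𝕃_p}` EQUALS `−|log(Θ)|_p` ⟺ every collection has room at some content-minimising slot -/

/-- **READING (U) AT THE PRIME: `ln ν̄_{𝕃_p}(reading (U) over H) = −|log(Θ)|_p ⟺ EVERY COLLECTION HAS A CONTENT-MINIMISING SLOT WITH ROOM (⟸ mod
`JannsenWingbergMappingClass`, ⟹ unconditional).**  Every place of the section over `p` tame of odd local degree `≥ 3` (any residue degree); valuation family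
`‖t_{i,v_a}‖ = p^{−v(i,v⃗,a)/e(v̲_a|p)}` at every slot; bit oracle per place, correct at the residue-degree-one places; `H_{j,v⃗} ≤ indTwo` containing the
single-factor strip moves and acting factorwise.  With `A(i,v⃗,a) = (v(i,v⃗,a)−1) div e(v̲_a|p) + 1 − (j+1)`:
`ln ν̄_{𝕃_p}(v⃗ ↦ hull(⋃_{g∈H_{v⃗}} g(⋃_σ σ·O_𝕃(−P_Θ)_{v⃗∘σ}))) = −|log(Θ)|_p ⟺ ∀ (i,v⃗) ∃ a, A(i,v⃗,a) = min_{a'} A(i,v⃗,a') ∧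
((v(i,v⃗,a)−1) % e(v̲_a|p) + 1)/e(v̲_a|p) + Σ_{b : f(v̲_b|p) = 1 ∧ ¬bit(v_b)} 1/e(v̲_b|p) ≤ 1`; when the right side fails the left side is `<` (gen 21's (π′4)).
[claim: Mochizuki2012, status: disputed] [cite: Mochizuki2012, IUTchIII Thm. 3.11 (i) p. 154; Cor. 3.12 p. 174, Step (xi) p. 183; IUTchIV Prop. 1.1 p. 9,
Prop. 1.2 (ii) pp. 10–11] [cite: Kondo2025OuterAutMLF, §3 Thm 3.17, Rem 3.18] [cite: DupuyHilado2025, Def. 3.6.3, §4.7, §4.11, §4.12] -/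
theorem localFields_lnνLp_hull_orbitH_indOneUnion_eq_negLogThetaAt_iff_forall_exists_room_at_min_of_jannsenWingbergMappingClass
    (hMC : JannsenWingbergMappingClass) (hp2 : 2 < p) {lstar : ℕ}
    (t : Fin lstar → (v : placesOver F₀ p) → ((σ.localFields p).k v)ˣ)
    (he : ∀ v : placesOver F₀ p, absRamificationIdx p ((σ.localFields p).k v) ≤ p - 2)
    (h3 : ∀ v : placesOver F₀ p, 3 ≤ localDeg K (σ.lift v.1)) (hodd : ∀ v : placesOver F₀ p, Odd (localDeg K (σ.lift v.1)))
    (v : (i : Fin lstar) → (Fin ((i : ℕ) + 1 + 1) → placesOver F₀ p) → Fin ((i : ℕ) + 1 + 1) → ℤ)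
    (hv : ∀ (i : Fin lstar) (e : Fin ((i : ℕ) + 1 + 1) → placesOver F₀ p) (a : Fin ((i : ℕ) + 1 + 1)),
      ‖(t i (e a) : (σ.localFields p).k (e a))‖ = (p : ℝ) ^ (-(v i e a / (absRamificationIdx p ((σ.localFields p).k (e a)) : ℝ))))
    (bit : placesOver F₀ p → Prop) [DecidablePred bit]
    (hbit : ∀ w : placesOver F₀ p, (σ.lift w.1).asIdeal.inertiaDeg ℤ = 1 → bit w →
      ∃ ψ ∈ ind1StripOf (σ.lift w.1) (galoisLog (σ.lift w.1)),
        RescaledCompletion.of K p (σ.lift w.1) (σ.natCast_mem_lift w) (ψ (p : (σ.lift w.1).adicCompletion K)) -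
            (p : RescaledCompletion K p (σ.lift w.1) (σ.natCast_mem_lift w)) ∉
          (p : ℚ_[p]) • logUnits (RescaledCompletion K p (σ.lift w.1) (σ.natCast_mem_lift w)))
    (hfix : ∀ w : placesOver F₀ p, (σ.lift w.1).asIdeal.inertiaDeg ℤ = 1 → ¬ bit w →
      ∀ ψ ∈ ind1StripOf (σ.lift w.1) (galoisLog (σ.lift w.1)),
        RescaledCompletion.of K p (σ.lift w.1) (σ.natCast_mem_lift w) (ψ (p : (σ.lift w.1).adicCompletion K)) -
            (p : RescaledCompletion K p (σ.lift w.1) (σ.natCast_mem_lift w)) ∈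
          (p : ℚ_[p]) • logUnits (RescaledCompletion K p (σ.lift w.1) (σ.natCast_mem_lift w)))
    (H : (j : ℕ) → (e : Fin (j + 1) → placesOver F₀ p) →
      Subgroup (PacketAlgebra p (fun b => (σ.localFields p).k (e b)) ≃ₗ[ℚ_[p]]
        PacketAlgebra p (fun b => (σ.localFields p).k (e b))))
    (hH : ∀ j e, H j e ≤ indTwo p (fun b => (σ.localFields p).k (e b)))
    (hstrip : ∀ (i : Fin lstar) (e : Fin ((i : ℕ) + 1 + 1) → placesOver F₀ p) (b₀ : Fin ((i : ℕ) + 1 + 1)),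
      ∀ ψ ∈ ind1StripOf (σ.lift (e b₀).1) (galoisLog (σ.lift (e b₀).1)), ∃ γ ∈ H ((i : ℕ) + 1) e,
        ∀ z : ∀ b, (σ.localFields p).k (e b),
          (γ : PacketAlgebra p (fun b => (σ.localFields p).k (e b)) ≃ₗ[ℚ_[p]]
              PacketAlgebra p (fun b => (σ.localFields p).k (e b))) (PiTensorProduct.tprod ℚ_[p] z) =
            PiTensorProduct.tprod ℚ_[p] (update z b₀
              (RescaledCompletion.of K p (σ.lift (e b₀).1) (σ.natCast_mem_lift (e b₀))
                (ψ ((RescaledCompletion.of K p (σ.lift (e b₀).1) (σ.natCast_mem_lift (e b₀))).symm (z b₀))))))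
    (hHfac : ∀ (i : Fin lstar) (e : Fin ((i : ℕ) + 1 + 1) → placesOver F₀ p), ∀ γ ∈ H ((i : ℕ) + 1) e,
      ∃ δ : Π b, AddAut ((σ.lift (e b).1).adicCompletion K),
        (∀ b, δ b ∈ AddSubgroup.closure (G := AddAut ((σ.lift (e b).1).adicCompletion K))
          (ind1StripOf (σ.lift (e b).1) (galoisLog (σ.lift (e b).1)))) ∧
        ∀ z : Π b, (σ.localFields p).k (e b),
          (γ : PacketAlgebra p (fun b => (σ.localFields p).k (e b)) ≃ₗ[ℚ_[p]]
              PacketAlgebra p (fun b => (σ.localFields p).k (e b))) (PiTensorProduct.tprod ℚ_[p] z) =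
            PiTensorProduct.tprod ℚ_[p] (fun b => RescaledCompletion.of K p (σ.lift (e b).1) (σ.natCast_mem_lift (e b))
              (δ b ((RescaledCompletion.of K p (σ.lift (e b).1) (σ.natCast_mem_lift (e b))).symm (z b))))) :
    (realPrimePacketWith p (σ.localFields p) c hc0 hcσ).lnνLp lstar (fun j e =>
        packetHull p (fun b => (σ.localFields p).k (e b))
          (⋃ g : H j e, (g : PacketAlgebra p (fun b => (σ.localFields p).k (e b)) ≃ₗ[ℚ_[p]]
              PacketAlgebra p (fun b => (σ.localFields p).k (e b))) ''
            ⋃ τ : Equiv.Perm (Fin (j + 1)), (realPrimePacketWith p (σ.localFields p) c hc0 hcσ).perm τ e ''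
              (realPrimePacketWith p (σ.localFields p) c hc0 hcσ).pilotRegion t j (e ∘ τ))) =
      (realPrimePacketWith p (σ.localFields p) c hc0 hcσ).negLogThetaAt lstar t ↔
    ∀ (i : Fin lstar) (e : Fin ((i : ℕ) + 1 + 1) → placesOver F₀ p), ∃ a,
      (v i e a - 1) / (absRamificationIdx p ((σ.localFields p).k (e a)) : ℤ) + 1 - Fintype.card (Fin ((i : ℕ) + 1 + 1)) =
          Finset.univ.inf' Finset.univ_nonempty
            (fun a => (v i e a - 1) / (absRamificationIdx p ((σ.localFields p).k (e a)) : ℤ) + 1 - Fintype.card (Fin ((i : ℕ) + 1 + 1))) ∧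
        (((v i e a - 1) % (absRamificationIdx p ((σ.localFields p).k (e a)) : ℤ) + 1 : ℤ) : ℝ) /
            (absRamificationIdx p ((σ.localFields p).k (e a)) : ℝ) +
          ∑ b ∈ Finset.univ \ Finset.univ.filter (fun b => (σ.lift (e b).1).asIdeal.inertiaDeg ℤ ≠ 1 ∨ bit (e b)),
            (1 : ℝ) / (absRamificationIdx p ((σ.localFields p).k (e b)) : ℝ) ≤ 1 := by
  classical
  constructor
  · intro hEq i₁ e₁
    by_contra hnot
    set S : Finset (Fin ((i₁ : ℕ) + 1 + 1)) :=
      Finset.univ.filter (fun b => (σ.lift (e₁ b).1).asIdeal.inertiaDeg ℤ ≠ 1 ∨ bit (e₁ b)) with hS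
    have hmemS : ∀ b, b ∈ S ↔ (σ.lift (e₁ b).1).asIdeal.inertiaDeg ℤ ≠ 1 ∨ bit (e₁ b) := fun b => by simp [hS]
    have hfS : ∀ b, b ∉ S → (σ.lift (e₁ b).1).asIdeal.inertiaDeg ℤ = 1 := fun b hb => by
      by_contra h; exact hb ((hmemS b).mpr (Or.inl h))
    have hbS : ∀ b, b ∉ S → ¬ bit (e₁ b) := fun b hb hbit' => hb ((hmemS b).mpr (Or.inr hbit'))
    have he2 : ∀ b, b ∉ S → 2 ≤ absRamificationIdx p (RescaledCompletion K p (σ.lift (e₁ b).1) (σ.natCast_mem_lift (e₁ b))) :=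
      fun b hb => by
        have h := h3 (e₁ b)
        rw [localDeg, hfS b hb, mul_one, ← absRamificationIdx_rescaledCompletion K p (σ.lift (e₁ b).1) (σ.natCast_mem_lift (e₁ b))] at h
        omega
    have hnot' : ∀ a, (v i₁ e₁ a - 1) / (absRamificationIdx p ((σ.localFields p).k (e₁ a)) : ℤ) + 1 - Fintype.card (Fin ((i₁ : ℕ) + 1 + 1)) =
        Finset.univ.inf' Finset.univ_nonempty
          (fun a => (v i₁ e₁ a - 1) / (absRamificationIdx p ((σ.localFields p).k (e₁ a)) : ℤ) + 1 - Fintype.card (Fin ((i₁ : ℕ) + 1 + 1))) →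
      ¬ ((((v i₁ e₁ a - 1) % (absRamificationIdx p ((σ.localFields p).k (e₁ a)) : ℤ) + 1 : ℤ) : ℝ) /
          (absRamificationIdx p ((σ.localFields p).k (e₁ a)) : ℝ) +
        ∑ b ∈ Finset.univ \ S, (1 : ℝ) / (absRamificationIdx p ((σ.localFields p).k (e₁ b)) : ℝ) ≤ 1) :=
      fun a ha hr => hnot ⟨a, ha, hr⟩
    have hlt := localFields_lnνLp_hull_orbitH_indOneUnion_lt_negLogThetaAt_of_not_room_at_min σ p c hc0 hcσ hp2 t H hH i₁ e₁
      (fun b => he (e₁ b)) (v i₁ e₁) (hv i₁ e₁) S he2 hfS (fun b hb => hfix (e₁ b) (hfS b hb) (hbS b hb)) hnot' (hHfac i₁ e₁)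
    rw [hEq] at hlt
    exact lt_irrefl _ hlt
  · intro hroom
    unfold PrimePacket.negLogThetaAt
    refine (realPrimePacketWith p (σ.localFields p) c hc0 hcσ).lnνLp_congr_of_succ lstar fun i e => ?_
    exact (localFields_packetHull_orbitH_indOneUnion_pilotRegion_eq_possibleImagesHull_iff_exists_room_at_min_of_jannsenWingbergMappingClass σ p
      c hc0 hcσ hMC hp2 t i e (fun b => he (e b)) (fun b => h3 (e b)) (fun b => hodd (e b)) (v i e) (hv i e) (fun b => bit (e b))
      (fun b hf1 hb => hbit (e b) hf1 hb) (fun b hf1 hb => hfix (e b) hf1 hb) (H _ e) (hH _ e) (hstrip i e) (hHfac i e)).mpr (hroom i e)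

/-! ## §4 Non-vacuity of the hypotheses on the family `H` -/

/-- **NON-VACUITY: the three hypotheses on the FAMILY `H = (H_{j,v⃗})` of §2–§3 are jointly inhabited (UNCONDITIONAL).**  At every collection `v⃗ = e` take the
subgroup generated by the single-factor (Ind1) strip moves lying in `indTwo` (R28 (λ3) `exists_subgroup_le_indTwo_stripMoves_factorwise`): it is `≤ indTwo`,
contains every single-factor strip move and acts factorwise through the realised strip groups.  So the equivalences of §2–§3 speak about an inhabited class of
families. [claim: Mochizuki2012, status: disputed] [cite: Mochizuki2012, IUTchIII Thm. 3.11 (i) p. 154] [cite: DupuyHilado2025, §4.9] -/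
theorem exists_subgroupFamily_le_indTwo_stripMoves_factorwise (lstar : ℕ) :
    ∃ H : (j : ℕ) → (e : Fin (j + 1) → placesOver F₀ p) →
        Subgroup (PacketAlgebra p (fun b => (σ.localFields p).k (e b)) ≃ₗ[ℚ_[p]]
          PacketAlgebra p (fun b => (σ.localFields p).k (e b))),
      (∀ j e, H j e ≤ indTwo p (fun b => (σ.localFields p).k (e b))) ∧
      (∀ (i : Fin lstar) (e : Fin ((i : ℕ) + 1 + 1) → placesOver F₀ p) (b₀ : Fin ((i : ℕ) + 1 + 1)),
        ∀ ψ ∈ ind1StripOf (σ.lift (e b₀).1) (galoisLog (σ.lift (e b₀).1)), ∃ γ ∈ H ((i : ℕ) + 1) e,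
          ∀ z : ∀ b, (σ.localFields p).k (e b),
            (γ : PacketAlgebra p (fun b => (σ.localFields p).k (e b)) ≃ₗ[ℚ_[p]]
                PacketAlgebra p (fun b => (σ.localFields p).k (e b))) (PiTensorProduct.tprod ℚ_[p] z) =
              PiTensorProduct.tprod ℚ_[p] (update z b₀
                (RescaledCompletion.of K p (σ.lift (e b₀).1) (σ.natCast_mem_lift (e b₀))
                  (ψ ((RescaledCompletion.of K p (σ.lift (e b₀).1) (σ.natCast_mem_lift (e b₀))).symm (z b₀)))))) ∧
      ∀ (i : Fin lstar) (e : Fin ((i : ℕ) + 1 + 1) → placesOver F₀ p), ∀ γ ∈ H ((i : ℕ) + 1) e,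
        ∃ δ : Π b, AddAut ((σ.lift (e b).1).adicCompletion K),
          (∀ b, δ b ∈ AddSubgroup.closure (G := AddAut ((σ.lift (e b).1).adicCompletion K))
            (ind1StripOf (σ.lift (e b).1) (galoisLog (σ.lift (e b).1)))) ∧
          ∀ z : Π b, (σ.localFields p).k (e b),
            (γ : PacketAlgebra p (fun b => (σ.localFields p).k (e b)) ≃ₗ[ℚ_[p]]
                PacketAlgebra p (fun b => (σ.localFields p).k (e b))) (PiTensorProduct.tprod ℚ_[p] z) =
              PiTensorProduct.tprod ℚ_[p] (fun b => RescaledCompletion.of K p (σ.lift (e b).1) (σ.natCast_mem_lift (e b))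
                (δ b ((RescaledCompletion.of K p (σ.lift (e b).1) (σ.natCast_mem_lift (e b))).symm (z b)))) := by
  classical
  have hex := fun (j : ℕ) (e : Fin (j + 1) → placesOver F₀ p) =>
    exists_subgroup_le_indTwo_stripMoves_factorwise p (fun b => σ.lift (e b).1) (fun b => σ.natCast_mem_lift (e b))
  choose H hH hstrip hHfac using hex
  exact ⟨H, hH, fun i e b₀ ψ hψ => hstrip _ e b₀ ψ hψ, fun i e γ hγ => hHfac _ e γ hγ⟩

end PlaceSection

end Summit.ABC.IUTFork.Thm311.Real

end
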